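import Literature.NumberTheory.LFunctions.WeilMellinInversion
import Literature.NumberTheory.LFunctions.WeilResolventVector
import Literature.Analysis.FunctionSpaces.PlancherelL1L2
import Summits.RiemannHypothesis.RiemannHypothesis.Theorems.WeilGroundStateGroundStatesConvergeToXiStubMomentsOfStrip
import HarnessLib

/-!
# Stub `stub_plancherelBudget` of the line `Sketch` (crux `WeilGroundState.GroundStatesConvergeToXi`,
item stmt-RiemannHypothesis-1527, rev L9)

**The Plancherel budget of a windowed `L²` function.**  Let `u ∈ L²(ℝ)` vanish a.e. off the
window `[-a, a]` (`0 < a`) and write `û = weilMellin u`, `û(s) = ∫ u(t) e^{(s-1/2)t} dt`.  Then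
1. `û` is entire (`hasDerivAt_weilMellin_of_ae_eq_zero`: `u` is integrable on the compact window,
   being `L²` on a set of finite measure);
2. `û⁽ⁿ⁾ = (u·yⁿ)^` for every `n` (`momentsOfStrip_iteratedDeriv`: all exponential moments
   `∫ ‖u‖ e^{A|t|}` are finite since the weight is continuous and `u` lives on the window);
3. for `n : ℕ` and `x ∈ [0, 1]`, `t ↦ ‖(u·yⁿ)^(x + it)‖²` is integrable and
   `∫ ‖(u·yⁿ)^(x + it)‖² dt ≤ 2π a²ⁿ eᵃ ∫ ‖u‖²`.
   Indeed with `v(y) = u(y) yⁿ e^{(x-1/2)y}` one has `𝓕 v (w) = (u·yⁿ)^(x - 2πiw)`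
   (`fourier_weilKernel`), `v ∈ L¹ ∩ L²` with `‖v(y)‖ ≤ aⁿ e^{a/2} ‖u(y)‖` a.e. (`|y| ≤ a` and
   `|x - 1/2| ≤ 1/2` on the window), so Plancherel for `L¹ ∩ L²`
   (`Literature.Analysis.FunctionSpaces.integral_norm_sq_fourierIntegral_eq`) and the substitution
   `t = -2πw` (`Measure.integral_comp_mul_left`, as in `integral_norm_sq_weilMellin_half_line`) give
   `∫ ‖(u·yⁿ)^(x+it)‖² dt = 2π ∫ ‖v‖² ≤ 2π a²ⁿ eᵃ ∫ ‖u‖²`.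
-/

set_option linter.dupNamespace false

noncomputable section

open MeasureTheory Complex Filter Set
open scoped Real Topology ComplexConjugate FourierTransform

namespace Summit.RiemannHypothesis.RiemannHypothesis.Theorems.GroundStatesConvergeToXi

open Literature.NumberTheory.LFunctions

/-- **Plancherel on a vertical line in the `weilMellin` normalisation.**  If the kernel
`v(t) = g(t) e^{(x-1/2)t}` lies in `L¹ ∩ L²`, then `t ↦ ‖ĝ(x + it)‖²` is integrable and
`∫ ‖ĝ(x + it)‖² dt = 2π ∫ ‖v‖²` (`𝓕 v (w) = ĝ(x - 2πiw)` by `fourier_weilKernel`, Plancherel for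
`L¹ ∩ L²`, and the substitution `t = -2πw`). [folklore] -/
theorem plancherelBudget_vertical (g : ℝ → ℂ) (x : ℝ)
    (h1 : Integrable (fun t : ℝ => g t * cexp (((x : ℂ) - 1 / 2) * t)))
    (h2 : MemLp (fun t : ℝ => g t * cexp (((x : ℂ) - 1 / 2) * t)) 2) :
    Integrable (fun t : ℝ => ‖weilMellin g (x + t * I)‖ ^ 2) ∧
      ∫ t : ℝ, ‖weilMellin g (x + t * I)‖ ^ 2 =
        2 * π * ∫ t : ℝ, ‖g t * cexp (((x : ℂ) - 1 / 2) * t)‖ ^ 2 := by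
  -- adapted from `integral_norm_sq_weilMellin_half_line`
  -- (Literature/NumberTheory/LFunctions/WeilArchimedeanMoments.lean)
  set v : ℝ → ℂ := fun t : ℝ => g t * cexp (((x : ℂ) - 1 / 2) * t) with hv
  have hP := Literature.Analysis.FunctionSpaces.integral_norm_sq_fourierIntegral_eq h1 h2
  have hFm := Literature.Analysis.FunctionSpaces.memLp_two_fourierIntegral h1 h2
  have hFi : Integrable (fun w : ℝ => ‖𝓕 v w‖ ^ 2) :=
    (memLp_two_iff_integrable_sq_norm hFm.1).1 hFm
  have hF : ∀ w : ℝ, 𝓕 v w = weilMellin g (x + ((-(2 * π * w) : ℝ) : ℂ) * I) :=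
    fourier_weilKernel g x
  set f : ℝ → ℝ := fun t => ‖weilMellin g (x + t * I)‖ ^ 2 with hf
  have e1 : (fun w : ℝ => f (-(2 * π) * w)) = fun w => ‖𝓕 v w‖ ^ 2 := by
    funext w
    rw [hF, hf]
    simp only
    congr 3
    push_cast
    ring
  have h2pi : (0 : ℝ) < 2 * π := by positivity
  refine ⟨?_, ?_⟩
  · rw [← e1] at hFi
    exact (integrable_comp_mul_left_iff f (neg_ne_zero.2 h2pi.ne')).1 hFi
  · have hsub := Measure.integral_comp_mul_left f (-(2 * π))
    rw [e1, hP] at hsub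
    have hpi : |(-(2 * π))⁻¹| = (2 * π)⁻¹ := by
      rw [inv_neg, abs_neg, abs_of_pos (by positivity)]
    rw [hpi, smul_eq_mul] at hsub
    -- hsub : ∫ ‖v‖² = (2π)⁻¹ * ∫ f
    rw [hsub, ← mul_assoc, mul_inv_cancel₀ h2pi.ne', one_mul]

/-- A function integrable on the window `[-a, a]` and a.e. zero off it has all exponential
moments finite: `∫ ‖u(t)‖ e^{A|t|} dt < ∞` for every real `A`. [folklore] -/
theorem plancherelBudget_expMoment {a : ℝ} {u : ℝ → ℂ} (hint : IntegrableOn u (Icc (-a) a))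
    (hae : ∀ᵐ t : ℝ, t ∉ Icc (-a) a → u t = 0) (A : ℝ) :
    Integrable (fun t : ℝ => ‖u t‖ * Real.exp (A * |t|)) := by
  -- adapted from `momentsOfStrip_expMoment_groundState`
  have h := (integrable_mul_continuous_of_ae_eq_zero hint hae
    (w := fun t : ℝ => ((Real.exp (A * |t|) : ℝ) : ℂ)) (by fun_prop)).norm
  refine h.congr (ae_of_all _ fun t => ?_)
  simp only [norm_mul, Complex.norm_real, Real.norm_eq_abs, Real.abs_exp]

/-- Pointwise size of the kernel on the window: for `x ∈ [0, 1]` and `y ∈ [-a, a]`,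
`‖z yⁿ e^{(x-1/2)y}‖ ≤ aⁿ e^{a/2} ‖z‖`. [folklore] -/
theorem plancherelBudget_norm_kernel_le {a x y : ℝ} (n : ℕ) (hx : x ∈ Icc (0 : ℝ) 1)
    (hy : y ∈ Icc (-a) a) (z : ℂ) :
    ‖z * (y : ℂ) ^ n * cexp (((x : ℂ) - 1 / 2) * y)‖ ≤ a ^ n * Real.exp (a / 2) * ‖z‖ := by
  rw [norm_mul, norm_mul, Complex.norm_exp, norm_pow, Complex.norm_real, Real.norm_eq_abs]
  have hre : (((x : ℂ) - 1 / 2) * (y : ℂ)).re = (x - 1 / 2) * y := by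
    simp [sub_re, mul_re]
  rw [hre]
  have hya : |y| ≤ a := abs_le.2 ⟨hy.1, hy.2⟩
  have h1 : |y| ^ n ≤ a ^ n := pow_le_pow_left₀ (abs_nonneg _) hya n
  have h2 : Real.exp ((x - 1 / 2) * y) ≤ Real.exp (a / 2) := by
    refine Real.exp_le_exp.2 ?_
    have hx' : |x - 1 / 2| ≤ 1 / 2 := abs_le.2 ⟨by linarith [hx.1], by linarith [hx.2]⟩
    calc (x - 1 / 2) * y ≤ |(x - 1 / 2) * y| := le_abs_self _
      _ = |x - 1 / 2| * |y| := abs_mul _ _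
      _ ≤ 1 / 2 * a := mul_le_mul hx' hya (abs_nonneg _) (by norm_num)
      _ = a / 2 := by ring
  have ha : 0 ≤ a ^ n := pow_nonneg ((abs_nonneg y).trans hya) n
  calc ‖z‖ * |y| ^ n * Real.exp ((x - 1 / 2) * y) ≤ ‖z‖ * a ^ n * Real.exp (a / 2) := by
        gcongr
    _ = a ^ n * Real.exp (a / 2) * ‖z‖ := by ring

/-- **Stub `stub_plancherelBudget` (W6b, RH-free).**  For `u ∈ L²` vanishing a.e. off the window
`[-a, a]` (`0 < a`): `û = weilMellin u` is entire, `iteratedDeriv n û = weilMellin (u·yⁿ)`, and on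
every vertical line `Re s = x`, `x ∈ [0, 1]`, the Plancherel budget
`∫ ‖weilMellin (u·yⁿ) (x + it)‖² dt ≤ 2π a²ⁿ eᵃ ∫ ‖u‖²` holds (with the integrand integrable).
[folklore] -/
theorem stub_plancherelBudget :
    ∀ (a : ℝ) (u : ℝ → ℂ), 0 < a → MemLp u 2 volume → (∀ᵐ t : ℝ, t ∉ Icc (-a) a → u t = 0) →
      Differentiable ℂ (weilMellin u) ∧
      (∀ n : ℕ, iteratedDeriv n (weilMellin u) = weilMellin (fun y : ℝ => u y * (y : ℂ) ^ n)) ∧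
      ∀ (n : ℕ) (x : ℝ), x ∈ Icc (0 : ℝ) 1 →
        Integrable (fun t : ℝ => ‖weilMellin (fun y : ℝ => u y * (y : ℂ) ^ n) (x + t * I)‖ ^ 2) ∧
        ∫ t : ℝ, ‖weilMellin (fun y : ℝ => u y * (y : ℂ) ^ n) (x + t * I)‖ ^ 2 ≤
          2 * π * a ^ (2 * n) * Real.exp a * ∫ y : ℝ, ‖u y‖ ^ 2 := by
  intro a u _ha hu hae
  have hint : IntegrableOn u (Icc (-a) a) := (hu.restrict (Icc (-a) a)).integrable one_le_two
  have hM := plancherelBudget_expMoment hint hae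
  refine ⟨fun s => (hasDerivAt_weilMellin_of_ae_eq_zero hint hae s).differentiableAt,
    fun n => momentsOfStrip_iteratedDeriv n hu.1 hM, fun n x hx => ?_⟩
  -- the kernel `v(y) = u(y) yⁿ e^{(x-1/2)y}` on the line `Re s = x`
  set g : ℝ → ℂ := fun y => u y * (y : ℂ) ^ n with hg
  have hv_eq : (fun t : ℝ => g t * cexp (((x : ℂ) - 1 / 2) * t)) =
      fun t => u t * ((t : ℂ) ^ n * cexp (((x : ℂ) - 1 / 2) * t)) := by
    funext t
    simp only [hg]
    ring
  have h1 : Integrable (fun t : ℝ => g t * cexp (((x : ℂ) - 1 / 2) * t)) := by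
    rw [hv_eq]
    exact integrable_mul_continuous_of_ae_eq_zero hint hae (by fun_prop)
  have hbound : ∀ᵐ t : ℝ, ‖g t * cexp (((x : ℂ) - 1 / 2) * t)‖ ≤
      a ^ n * Real.exp (a / 2) * ‖u t‖ := by
    filter_upwards [hae] with t ht
    by_cases hta : t ∈ Icc (-a) a
    · exact plancherelBudget_norm_kernel_le n hx hta (u t)
    · simp only [hg, ht hta, zero_mul, norm_zero, mul_zero, le_refl]
  have h2 : MemLp (fun t : ℝ => g t * cexp (((x : ℂ) - 1 / 2) * t)) 2 :=
    MemLp.of_le_mul hu h1.aestronglyMeasurable hbound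
  obtain ⟨hI, hE⟩ := plancherelBudget_vertical g x h1 h2
  refine ⟨hI, ?_⟩
  rw [hE]
  -- `∫ ‖v‖² ≤ a²ⁿ eᵃ ∫ ‖u‖²`
  have hu2 : Integrable (fun t : ℝ => ‖u t‖ ^ 2) := (memLp_two_iff_integrable_sq_norm hu.1).1 hu
  have hv2 : Integrable (fun t : ℝ => ‖g t * cexp (((x : ℂ) - 1 / 2) * t)‖ ^ 2) :=
    (memLp_two_iff_integrable_sq_norm h2.1).1 h2
  have hC : (a ^ n * Real.exp (a / 2)) ^ 2 = a ^ (2 * n) * Real.exp a := by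
    rw [mul_pow, ← pow_mul, mul_comm n 2, sq (Real.exp _), ← Real.exp_add, add_halves]
  have hle : ∫ t : ℝ, ‖g t * cexp (((x : ℂ) - 1 / 2) * t)‖ ^ 2 ≤
      a ^ (2 * n) * Real.exp a * ∫ y : ℝ, ‖u y‖ ^ 2 := by
    rw [← integral_const_mul]
    refine integral_mono_ae hv2 (hu2.const_mul _) ?_
    filter_upwards [hbound] with t ht
    calc ‖g t * cexp (((x : ℂ) - 1 / 2) * t)‖ ^ 2
        ≤ (a ^ n * Real.exp (a / 2) * ‖u t‖) ^ 2 := pow_le_pow_left₀ (norm_nonneg _) ht 2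
      _ = a ^ (2 * n) * Real.exp a * ‖u t‖ ^ 2 := by rw [mul_pow, hC]
  calc 2 * π * ∫ t : ℝ, ‖g t * cexp (((x : ℂ) - 1 / 2) * t)‖ ^ 2
      ≤ 2 * π * (a ^ (2 * n) * Real.exp a * ∫ y : ℝ, ‖u y‖ ^ 2) :=
        mul_le_mul_of_nonneg_left hle (by positivity)
    _ = 2 * π * a ^ (2 * n) * Real.exp a * ∫ y : ℝ, ‖u y‖ ^ 2 := by ring

end Summit.RiemannHypothesis.RiemannHypothesis.Theorems.GroundStatesConvergeToXi

end
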